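import Literature.AlgebraicGeometry.HodgeTheory.FlagBundleSplitting
import Literature.AlgebraicGeometry.HodgeTheory.SurjectivePullbackConiveauDescent
import HarnessLib

/-!
# The flag bundle splitting fact in the two shapes the tree consumes: injective pull-back, and
# descent of geometric coniveau

Family `hodge`, layer `Literature/AlgebraicGeometry/HodgeTheory`. THEOREMS ONLY (no definition, no
named fact). For the named fact `FlagBundleSplitting` (`HodgeTheory/FlagBundleSplitting`: for a vector
bundle `F` on a smooth projective complex `X` there is a surjective `g : Y ⟶ X`, `Y` smooth projective,
with `g^*F` flagged — Fulton §3.2, Grothendieck 1958 §2) this file derives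

* `FlagBundleSplitting.exists_injective_hasFullFlag` — (`g^*` injective on `Hⁱ(−(ℂ); ℂ)` for all `i`
  ∧ `HasFullFlag (g^*F)`): literally the shape of the tree's named fact `SplittingPrincipleBetti`
  (`ChernCharacterBettiUniqueness` §1), by the PROVED `complexBetti_map_injective_of_surjective`
  (Voisin I Lemma 7.28);
* `FlagBundleSplitting.exists_descent_hasFullFlag`, `FlagBundleSplitting.exists_algebraic_descent_hasFullFlag`
  — (geometric coniveau descends along `g` in every degree: `g^* x ∈ Nᶜ Hᵏ(Y(ℂ); ℂ) ⟹ x ∈ Nᶜ Hᵏ(X(ℂ); ℂ)`,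
  in particular for `algebraicClasses = Nᵖ H²ᵖ` ∧ `HasFullFlag (g^*F)` ∧ `dim Y = dim X + d`), by the
  PROVED `mem_supportedClasses_of_map_mem_of_surjective'` (`x = c⁻¹ g_*(ηʳ ∪ g^* x)`, Voisin I Lemma 7.28
  with the wedge kept / Remark 7.29) and `dim_le_of_surjective`.

Use: the reduction of `chₖ(F(ℂ)) ∈ algebraicClasses X k` for an ARBITRARY vector bundle to the flagged
case (`Summits/HodgeConjecture/…/EightfoldBlochSeedsChernCharacterOnBettiAnalytificationFlag[Bundle]`).
Nothing here bears on any case of the Hodge conjecture.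

## References

* [Fulton1998] W. Fulton, *Intersection Theory*, 2nd ed. (1998), §3.2.
* [VoisinHodgeI2002] C. Voisin, *Hodge Theory and Complex Algebraic Geometry I* (2002), §7.3.2
  Lemma 7.28, Remark 7.29, Lemma 7.32, Thm. 7.33.
-/

noncomputable section

open CategoryTheory AlgebraicGeometry
open Literature.AlgebraicTopology.SingularHomology Literature.AlgebraicGeometry.Motives

namespace Literature.AlgebraicGeometry.HodgeTheory

section HodgeTheory



namespace FlagBundleSplitting

/-- **`FlagBundleSplitting` in the shape of `SplittingPrincipleBetti`**: for a vector bundle `F` on a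
smooth projective `X` there is `f : Y ⟶ X`, `Y` smooth projective, with `f^*` INJECTIVE on
`Hⁱ(−(ℂ); ℂ)` for every `i` and `f^*F` with a full flag (injectivity from surjectivity: the tree's
`complexBetti_map_injective_of_surjective`, Voisin I Lemma 7.28).
[cite: VoisinHodgeI2002, §7.3.2 Lemma 7.28, Lemma 7.32 and Thm. 7.33] [cite: Fulton1998, §3.2] -/
theorem exists_injective_hasFullFlag (h : FlagBundleSplitting) {n : ℕ} {X : SchemeOver ℂ}
    (hX : IsSmoothProjective n X) {F : X.left.Modules} (hF : IsVectorBundle F) :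
    ∃ (m : ℕ) (Y : SchemeOver ℂ) (f : Y ⟶ X), IsSmoothProjective m Y ∧
      (∀ i, Function.Injective (complexBetti.map f i)) ∧
      HasFullFlag ((Scheme.Modules.pullback f.left).obj F) := by
  obtain ⟨m, Y, g, hY, hg, hflag⟩ := h n X hX F hF
  exact ⟨m, Y, g, hY, fun i ↦ complexBetti_map_injective_of_surjective hX hY g i, hflag⟩

/-- **`FlagBundleSplitting` in the shape the coniveau arguments use**: for a vector bundle `F` on a
smooth projective `X` of dimension `n` there is `g : Y ⟶ X`, `Y` smooth projective of dimension
`n + d`, with `g^*F` flagged and such that geometric coniveau DESCENDS along `g` in every degree: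
`g^* x ∈ Nᶜ Hᵏ(Y(ℂ); ℂ) ⟹ x ∈ Nᶜ Hᵏ(X(ℂ); ℂ)` (the tree's
`mem_supportedClasses_of_map_mem_of_surjective'`, Voisin I Lemma 7.28 with the wedge kept, and
`dim_le_of_surjective`). [cite: Fulton1998, §3.2]
[cite: VoisinHodgeI2002, §7.3.2 Lemma 7.28 and Remark 7.29] -/
theorem exists_descent_hasFullFlag (h : FlagBundleSplitting) {n : ℕ} {X : SchemeOver ℂ}
    (hX : IsSmoothProjective n X) {F : X.left.Modules} (hF : IsVectorBundle F) :
    ∃ (d m : ℕ) (Y : SchemeOver ℂ) (g : Y ⟶ X), IsSmoothProjective m Y ∧ n + d = m ∧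
      HasFullFlag ((Scheme.Modules.pullback g.left).obj F) ∧
      ∀ (k c : ℕ) (x : complexBetti X k),
        complexBetti.map g k x ∈ supportedClasses Y k c → x ∈ supportedClasses X k c := by
  obtain ⟨m, Y, g, hY, hg, hflag⟩ := h n X hX F hF
  have hnm : n ≤ m := dim_le_of_surjective hY hX g
  exact ⟨m - n, m, Y, g, hY, by omega, hflag,
    fun k c x hx ↦ mem_supportedClasses_of_map_mem_of_surjective' hY hX g hx⟩

/-- **Algebraicity descends along the flag map**: the degree-`2p` / coniveau-`p` case of
`exists_descent_hasFullFlag` — `g^* x ∈ algebraicClasses Y p ⟹ x ∈ algebraicClasses X p`.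
[cite: Fulton1998, §3.2] [cite: VoisinHodgeI2002, §7.3.2 Lemma 7.28 and Remark 7.29] -/
theorem exists_algebraic_descent_hasFullFlag (h : FlagBundleSplitting) {n : ℕ} {X : SchemeOver ℂ}
    (hX : IsSmoothProjective n X) {F : X.left.Modules} (hF : IsVectorBundle F) :
    ∃ (m : ℕ) (Y : SchemeOver ℂ) (g : Y ⟶ X), IsSmoothProjective m Y ∧
      HasFullFlag ((Scheme.Modules.pullback g.left).obj F) ∧
      ∀ (p : ℕ) (x : complexBetti X (2 * p)),
        complexBetti.map g (2 * p) x ∈ algebraicClasses Y p → x ∈ algebraicClasses X p := by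
  obtain ⟨m, Y, g, hY, hg, hflag⟩ := h n X hX F hF
  exact ⟨m, Y, g, hY, hflag, fun p x hx ↦ mem_algebraicClasses_of_map_mem_of_surjective' hY hX g hx⟩

end FlagBundleSplitting

end HodgeTheory

end Literature.AlgebraicGeometry.HodgeTheory

end
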